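import Mathlib
import HarnessLib
import Summits.CriticalPhenomena.Ising3DConformalLimit.Theses.ModularQuarterTurn

/-!
# Crux `ModularQuarterTurn.BallModularMoebius` (stmt-CriticalPhenomena-6494) — birth skeleton (`Lines/birth.lean`)

Skeleton registrar `planner-skel-stmt-CriticalPhenomena-6494-0`, 2026-08-17 (BC3 of the Lean birth
certificate, route re-audit bin REPAIRABLE).  The crux is FIXED: its decl and signature are the
route's (`Theses/ModularQuarterTurn.lean`); `BallModularMoebius_of` below concludes it BY NAME.

## The cut (zero offset ∣ cyclic bootstrap ∣ toroidal orbit)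

The crux says: for every admissible `(ρ, Δ, S)` (pointwise scaling limit of the critical `ℤ³`
correlators, normalised, non-degenerate, EUCLIDEAN invariant, scale covariant) and every `r > 0`
there is a box growth `L` such that the disc modular words
`W_L(δ; p) = ρ(δ)^n · Tr(∏ᵢ Gᵢ K^{φᵢ/2π})` (Gram kernel `K = Σ_η √(Pr Pr')` of the disc
`{x₂ = 0, x₀² + x₁² < (r/δ)²}`) converge, locally uniformly in `q = (c, p)`, to the Möbius target
`T(c, p) = (∏ Jᵢ)^Δ · S n (M_{c + ψᵢ}(aᵢ, bᵢ))`.  Two structural facts about the crux AS TYPED drive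
the cut: the lattice word `W_L` does not contain the offset `c = q.1`, and neither does the
convergence domain (its non-coincidence clause is written at offset `0`).  Hence the crux is
EXACTLY "zero-offset convergence" + "the target is constant along the toroidal orbit `c`", and the
second half is inversion covariance of `S` in disguise.  The line makes the lattice pay for that
second half through TRACE CYCLICITY:

* `stub_zeroOffsetFlow` (OPEN — the heart; the crux restricted to the slice `q.1 = 0`): the disc
  modular words converge to the Möbius target at zero toroidal offset.  Strictly weaker than the
  crux as typed (no claim along the orbit `c ≠ 0`); this is where lattice Hislop–Longo/CHM lives
  (half-turn `K^{1/2}` = inversion in the rim sphere is its `φ = (π, π)` instance, plan item B1).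
* `stub_cyclicInversion` (cyclic bootstrap, provable-scale L): zero-offset convergence for all
  radii `r`, all `n` and all insertion lists ⇒ `IsInversionCovariant Δ S`.  Mechanism: the word is
  a trace, so it is invariant under cyclic rotation of the insertion list
  `((φ₁,p₁),…,(φₙ,pₙ)) ↦ ((φ₂,p₂),…,(φₙ,pₙ),(φ₁,p₁))`, while the zero-offset target of the rotated
  list is the target of the original list at offset `-φ₁` (angles are cumulative, `M_ψ`, `J` are
  `2π`-periodic, `S` is permutation symmetric — `ModularQuarterTurnToroidal.perm_symm`).  Uniqueness
  of limits along `𝓝[>] 0` therefore gives covariance of `S n` at every configuration `y` under the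
  toroidal rotation about ANY circle (Euclidean invariance moves the circle, every `r > 0` is
  allowed) by ANY difference of toroidal angles of two points of `y`; the angle difference `π` is
  realised by a pencil sphere separating two points of unequal distance to the centre (the radius
  is free by scale covariance), and the equal-distance configurations are reached through the
  cocycle `𝒢(y) ∋ g, 𝒢(g y) ∋ h ⇒ h ∘ g ∈ 𝒢(y)` with a generic auxiliary inversion; `n = 1` is
  `S 1 ≡ 0` (translation invariance + scale covariance, `Δ > 0`).  Toroidal closed forms:
  `Theorems/ModularQuarterTurnToroidalInversionUpgradeGeometry.lean` (`Mf`, `Jf`, `backward`, `core`).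
* `stub_toroidalOrbit` (Möbius bookkeeping, provable-scale M; converse of the proved support item
  `ToroidalInversionUpgrade`): Euclidean invariance + scale covariance + inversion covariance ⇒ the
  weighted target is constant in the offset on the disc domain, `T(c, p) = T(0, p)`: the toroidal
  rotation `R_c` about the rim circle is a Möbius map with `M_{c+ψ} = R_c ∘ M_ψ` and
  `J(c+ψ) = |R_c'(M_ψ p)|·J(ψ)` (chain rule for conformal factors), and no disc point off the centre
  is sent to `∞`.

`BallModularMoebius_of` (hypotheses = the name-keyed aliases `Registered.stub_*` of the three stub
statements, verbatim) is the genuine assembly (no sorry): slice convergence + offset-constancy of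
the target + offset-freeness of word and domain ⇒ locally uniform convergence on the whole domain
(`tendstoLocallyUniformlyOn_of_slice`: pull the slice neighbourhood back along the continuous
retraction `q ↦ (0, q.2)`).

Disproof used: none exists for this crux yet (`ledger crux ls`: no workfiles before this one).
Negatives index: the summit's refuted statements (SAW / other routes) are not touched; no stub is an
instance of a landed `Negative/` lemma (there is none under `Theorems/BallModularMoebius/`).
BC3 probes (registrar's folder `bc/probe_*.lean`): for each stub, `stub → BallModularMoebius` and
`stub → Ising3DConformalLimit` by `first | exact? | simpa | simpa [BallModularMoebius] | aesop` FAIL.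
-/

set_option maxHeartbeats 1000000

namespace Summit.CriticalPhenomena.Ising3DConformalLimit.Cruxes.BallModularMoebius.Birth

open scoped BigOperators Topology Manifold Classical MeasureTheory ProbabilityTheory Matrix InnerProductSpace ComplexConjugate ContinuousMap
open Filter Set Function TopologicalSpace MeasureTheory

/-- stub 1 (OPEN; the heart of the crux, strictly weaker than it as typed): **zero-offset disc
modular flow** — the interpolated disc words converge to the Möbius-transported, conformally
weighted `S` on the slice `q.1 = 0` of the crux's domain (same word, same target, same filter). -/
theorem stub_zeroOffsetFlow : ∀ (ρ : ℝ → ℝ) (Δ : ℝ) (S : Literature.Probability.LatticeModels.CorrFamily 3), (∀ δ ∈ Set.Ioc (0:ℝ) 1, 0 < ρ δ) → 0 < Δ → Literature.Probability.LatticeModels.HasPointwiseScalingLimit (Literature.Probability.LatticeModels.criticalCorr 3) ρ S → (∀ n z, z ∉ Literature.Probability.LatticeModels.NonCoincident 3 n → S n z = 0) → Literature.Probability.LatticeModels.IsNondegenerateTwoPoint S → Literature.Probability.LatticeModels.IsEuclideanInvariant S → Literature.Probability.LatticeModels.IsScaleCovariant Δ S → ∀ r : ℝ, 0 < r → ∃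 L : ℝ → ℕ, ∀ n : ℕ, TendstoLocallyUniformlyOn (fun (δ : ℝ) (q : ℝ × (Fin n → ℝ × ℝ × ℝ)) => ρ δ ^ n * (let D : Finset (Literature.Probability.LatticeModels.Site 3) := (Literature.Probability.LatticeModels.box 3 (L δ)).filter (fun x => x 2 = 0 ∧ ((x 0 : ℤ) : ℝ) ^ 2 + ((x 1 : ℤ) : ℝ) ^ 2 < (r / δ) ^ 2); let E : Finset (Literature.Probability.LatticeModels.Site 3) := (Literature.Probability.LatticeModels.box 3 (L δ)).filter (fun x => x 2 = 0 ∧ ¬ (((x 0 : ℤ) : ℝ) ^ 2 + ((x 1 : ℤ) : ℝ) ^ 2 < (r / δ) ^ 2)); let Pr : (↥D → ℤˣ) → (↥E → ℤˣ) → ℝ := fun σ η => Literature.Probability.LatticeModels.isingExpect (Literature.Probability.LatticeModels.zdGraph 3) (Literature.Probability.LatticeModels.box 3 (L δ)) (Literature.Probability.LatticeModels.criticalBeta 3) 0 Literature.Probability.LatticeModels.BoundaryCondition.plus (fun ω => (∏ x : ↥D, if ω x.1 = σ x then (1:ℝ) else 0) * ∏ y : ↥E, if ω y.1 = η y then (1:ℝ)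 else 0); let K : Matrix (↥D → ℤˣ) (↥D → ℤˣ) ℝ := Matrix.of (fun τ' τ => ∑ η : ↥E → ℤˣ, Real.sqrt (Pr τ' η * Pr τ η)); let G : Fin n → Matrix (↥D → ℤˣ) (↥D → ℤˣ) ℝ := fun i => Matrix.diagonal (fun τ => if h : (![⌊(q.2 i).2.1 / δ⌋, ⌊(q.2 i).2.2 / δ⌋, 0] : Literature.Probability.LatticeModels.Site 3) ∈ D then (((τ ⟨_, h⟩ : ℤˣ) : ℤ) : ℝ) else 0); Matrix.trace ((List.ofFn (fun i : Fin n => G i * cfc (fun x : ℝ => x ^ ((q.2 i).1 / (2 * Real.pi))) K)).prod))) (fun q => (∏ i : Fin n, (2 / ((1 + (((q.2 i).2.1 ^ 2 + (q.2 i).2.2 ^ 2) / r ^ 2)) + (1 - (((q.2 i).2.1 ^ 2 + (q.2 i).2.2 ^ 2) / r ^ 2)) * Real.cos (q.1 + ∑ j : Fin n, if j < i then (q.2 j).1 else 0)))) ^ Δ * S n (fun i : Fin n => (!₂[(2 / ((1 + (((q.2 i).2.1 ^ 2 + (q.2 i).2.2 ^ 2) / r ^ 2)) + (1 - (((q.2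 i).2.1 ^ 2 + (q.2 i).2.2 ^ 2) / r ^ 2)) * Real.cos (q.1 + ∑ j : Fin n, if j < i then (q.2 j).1 else 0))) * (q.2 i).2.1, (2 / ((1 + (((q.2 i).2.1 ^ 2 + (q.2 i).2.2 ^ 2) / r ^ 2)) + (1 - (((q.2 i).2.1 ^ 2 + (q.2 i).2.2 ^ 2) / r ^ 2)) * Real.cos (q.1 + ∑ j : Fin n, if j < i then (q.2 j).1 else 0))) * (q.2 i).2.2, -(r / 2) * (1 - (((q.2 i).2.1 ^ 2 + (q.2 i).2.2 ^ 2) / r ^ 2)) * Real.sin (q.1 + ∑ j : Fin n, if j < i then (q.2 j).1 else 0) * (2 / ((1 + (((q.2 i).2.1 ^ 2 + (q.2 i).2.2 ^ 2) / r ^ 2)) + (1 - (((q.2 i).2.1 ^ 2 + (q.2 i).2.2 ^ 2) / r ^ 2)) * Real.cos (q.1 + ∑ j : Fin n, if j < i then (q.2 j).1 else 0)))] : EuclideanSpace ℝ (Fin 3)))) (nhdsWithin (0:ℝ) (Set.Ioi 0)) {q : ℝ × (Fin n → ℝ × ℝ × ℝ) | q.1 = 0 ∧ (∀ i, 0 ≤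 (q.2 i).1 ∧ 0 < (q.2 i).2.1 ^ 2 + (q.2 i).2.2 ^ 2 ∧ (q.2 i).2.1 ^ 2 + (q.2 i).2.2 ^ 2 < r ^ 2) ∧ ∑ i, (q.2 i).1 = 2 * Real.pi ∧ (fun i : Fin n => (!₂[(2 / ((1 + (((q.2 i).2.1 ^ 2 + (q.2 i).2.2 ^ 2) / r ^ 2)) + (1 - (((q.2 i).2.1 ^ 2 + (q.2 i).2.2 ^ 2) / r ^ 2)) * Real.cos (∑ j : Fin n, if j < i then (q.2 j).1 else 0))) * (q.2 i).2.1, (2 / ((1 + (((q.2 i).2.1 ^ 2 + (q.2 i).2.2 ^ 2) / r ^ 2)) + (1 - (((q.2 i).2.1 ^ 2 + (q.2 i).2.2 ^ 2) / r ^ 2)) * Real.cos (∑ j : Fin n, if j < i then (q.2 j).1 else 0))) * (q.2 i).2.2, -(r / 2) * (1 - (((q.2 i).2.1 ^ 2 + (q.2 i).2.2 ^ 2) / r ^ 2)) * Real.sin (∑ j : Fin n, if j < i then (q.2 j).1 else 0) * (2 / ((1 + (((q.2 i).2.1 ^ 2 + (q.2 i).2.2 ^ 2) / r ^ 2)) +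 (1 - (((q.2 i).2.1 ^ 2 + (q.2 i).2.2 ^ 2) / r ^ 2)) * Real.cos (∑ j : Fin n, if j < i then (q.2 j).1 else 0)))] : EuclideanSpace ℝ (Fin 3))) ∈ Literature.Probability.LatticeModels.NonCoincident 3 n} := by
  sorry

/-- stub 2 (cyclic bootstrap, size L): zero-offset convergence of the disc words for every radius
⇒ inversion covariance of `S`.  Trace cyclicity of the word + cumulative angles + permutation
symmetry of `S` give covariance under toroidal rotations about every circle by every inter-point
angle difference; pencil-sphere geometry, the free radius (scale covariance) and a cocycle step
reach the unit inversion at every configuration avoiding the origin. -/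
theorem stub_cyclicInversion : ∀ (ρ : ℝ → ℝ) (Δ : ℝ) (S : Literature.Probability.LatticeModels.CorrFamily 3), (∀ δ ∈ Set.Ioc (0:ℝ) 1, 0 < ρ δ) → 0 < Δ → Literature.Probability.LatticeModels.HasPointwiseScalingLimit (Literature.Probability.LatticeModels.criticalCorr 3) ρ S → (∀ n z, z ∉ Literature.Probability.LatticeModels.NonCoincident 3 n → S n z = 0) → Literature.Probability.LatticeModels.IsNondegenerateTwoPoint S → Literature.Probability.LatticeModels.IsEuclideanInvariant S → Literature.Probability.LatticeModels.IsScaleCovariant Δ S → (∀ r : ℝ, 0 < r → ∃ L : ℝ → ℕ, ∀ n : ℕ, TendstoLocallyUniformlyOn (fun (δ : ℝ) (q : ℝ × (Fin n → ℝ × ℝ × ℝ)) => ρ δ ^ n * (let D : Finset (Literature.Probability.LatticeModels.Site 3) := (Literature.Probability.LatticeModels.box 3 (L δ)).filter (fun x => x 2 = 0 ∧ ((x 0 : ℤ) : ℝ) ^ 2 + ((x 1 : ℤ) : ℝ) ^ 2 < (r / δ) ^ 2); let E : Finset (Literature.Probability.LatticeModels.Site 3) := (Literature.Probability.LatticeModels.box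 3 (L δ)).filter (fun x => x 2 = 0 ∧ ¬ (((x 0 : ℤ) : ℝ) ^ 2 + ((x 1 : ℤ) : ℝ) ^ 2 < (r / δ) ^ 2)); let Pr : (↥D → ℤˣ) → (↥E → ℤˣ) → ℝ := fun σ η => Literature.Probability.LatticeModels.isingExpect (Literature.Probability.LatticeModels.zdGraph 3) (Literature.Probability.LatticeModels.box 3 (L δ)) (Literature.Probability.LatticeModels.criticalBeta 3) 0 Literature.Probability.LatticeModels.BoundaryCondition.plus (fun ω => (∏ x : ↥D, if ω x.1 = σ x then (1:ℝ) else 0) * ∏ y : ↥E, if ω y.1 = η y then (1:ℝ) else 0); let K : Matrix (↥D → ℤˣ) (↥D → ℤˣ) ℝ := Matrix.of (fun τ' τ => ∑ η : ↥E → ℤˣ, Real.sqrt (Pr τ' η * Pr τ η)); let G : Fin n → Matrix (↥D → ℤˣ) (↥D → ℤˣ) ℝ := fun i => Matrix.diagonal (fun τ => if h : (![⌊(q.2 i).2.1 / δ⌋, ⌊(q.2 i).2.2 / δ⌋, 0] : Literature.Probability.LatticeModels.Site 3) ∈ D then (((τ ⟨_, h⟩ : ℤˣ) : ℤ) : ℝ)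 else 0); Matrix.trace ((List.ofFn (fun i : Fin n => G i * cfc (fun x : ℝ => x ^ ((q.2 i).1 / (2 * Real.pi))) K)).prod))) (fun q => (∏ i : Fin n, (2 / ((1 + (((q.2 i).2.1 ^ 2 + (q.2 i).2.2 ^ 2) / r ^ 2)) + (1 - (((q.2 i).2.1 ^ 2 + (q.2 i).2.2 ^ 2) / r ^ 2)) * Real.cos (q.1 + ∑ j : Fin n, if j < i then (q.2 j).1 else 0)))) ^ Δ * S n (fun i : Fin n => (!₂[(2 / ((1 + (((q.2 i).2.1 ^ 2 + (q.2 i).2.2 ^ 2) / r ^ 2)) + (1 - (((q.2 i).2.1 ^ 2 + (q.2 i).2.2 ^ 2) / r ^ 2)) * Real.cos (q.1 + ∑ j : Fin n, if j < i then (q.2 j).1 else 0))) * (q.2 i).2.1, (2 / ((1 + (((q.2 i).2.1 ^ 2 + (q.2 i).2.2 ^ 2) / r ^ 2)) + (1 - (((q.2 i).2.1 ^ 2 + (q.2 i).2.2 ^ 2) / r ^ 2)) * Real.cos (q.1 + ∑ j : Fin n, if j < i then (q.2 j).1 else 0))) * (q.2 i).2.2, -(r / 2) * (1 - (((q.2 i).2.1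 ^ 2 + (q.2 i).2.2 ^ 2) / r ^ 2)) * Real.sin (q.1 + ∑ j : Fin n, if j < i then (q.2 j).1 else 0) * (2 / ((1 + (((q.2 i).2.1 ^ 2 + (q.2 i).2.2 ^ 2) / r ^ 2)) + (1 - (((q.2 i).2.1 ^ 2 + (q.2 i).2.2 ^ 2) / r ^ 2)) * Real.cos (q.1 + ∑ j : Fin n, if j < i then (q.2 j).1 else 0)))] : EuclideanSpace ℝ (Fin 3)))) (nhdsWithin (0:ℝ) (Set.Ioi 0)) {q : ℝ × (Fin n → ℝ × ℝ × ℝ) | q.1 = 0 ∧ (∀ i, 0 ≤ (q.2 i).1 ∧ 0 < (q.2 i).2.1 ^ 2 + (q.2 i).2.2 ^ 2 ∧ (q.2 i).2.1 ^ 2 + (q.2 i).2.2 ^ 2 < r ^ 2) ∧ ∑ i, (q.2 i).1 = 2 * Real.pi ∧ (fun i : Fin n => (!₂[(2 / ((1 + (((q.2 i).2.1 ^ 2 + (q.2 i).2.2 ^ 2) / r ^ 2)) + (1 - (((q.2 i).2.1 ^ 2 + (q.2 i).2.2 ^ 2) / r ^ 2)) * Real.cos (∑ j : Fin n, if j < i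 then (q.2 j).1 else 0))) * (q.2 i).2.1, (2 / ((1 + (((q.2 i).2.1 ^ 2 + (q.2 i).2.2 ^ 2) / r ^ 2)) + (1 - (((q.2 i).2.1 ^ 2 + (q.2 i).2.2 ^ 2) / r ^ 2)) * Real.cos (∑ j : Fin n, if j < i then (q.2 j).1 else 0))) * (q.2 i).2.2, -(r / 2) * (1 - (((q.2 i).2.1 ^ 2 + (q.2 i).2.2 ^ 2) / r ^ 2)) * Real.sin (∑ j : Fin n, if j < i then (q.2 j).1 else 0) * (2 / ((1 + (((q.2 i).2.1 ^ 2 + (q.2 i).2.2 ^ 2) / r ^ 2)) + (1 - (((q.2 i).2.1 ^ 2 + (q.2 i).2.2 ^ 2) / r ^ 2)) * Real.cos (∑ j : Fin n, if j < i then (q.2 j).1 else 0)))] : EuclideanSpace ℝ (Fin 3))) ∈ Literature.Probability.LatticeModels.NonCoincident 3 n}) → Literature.Probability.LatticeModels.IsInversionCovariant Δ S := by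
  sorry

/-- stub 3 (Möbius bookkeeping, size M; converse of the proved `ToroidalInversionUpgrade`):
Euclidean invariance + scale covariance + inversion covariance ⇒ the conformally weighted target is
constant along the toroidal orbit: `T (c, p) = T (0, p)` on the disc domain. -/
theorem stub_toroidalOrbit : ∀ (ρ : ℝ → ℝ) (Δ : ℝ) (S : Literature.Probability.LatticeModels.CorrFamily 3), (∀ δ ∈ Set.Ioc (0:ℝ) 1, 0 < ρ δ) → 0 < Δ → Literature.Probability.LatticeModels.HasPointwiseScalingLimit (Literature.Probability.LatticeModels.criticalCorr 3) ρ S → (∀ n z, z ∉ Literature.Probability.LatticeModels.NonCoincident 3 n → S n z = 0) → Literature.Probability.LatticeModels.IsNondegenerateTwoPoint S → Literature.Probability.LatticeModels.IsEuclideanInvariant S → Literature.Probability.LatticeModels.IsScaleCovariant Δ S → Literature.Probability.LatticeModels.IsInversionCovariant Δ S → ∀ r : ℝ, 0 < r → ∀ n : ℕ, ∀ q : ℝ × (Fin n → ℝ × ℝ × ℝ), q ∈ {q : ℝ × (Fin n → ℝ × ℝ × ℝ) | (∀ i, 0 ≤ (q.2 i).1 ∧ 0 < (q.2 i).2.1 ^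 2 + (q.2 i).2.2 ^ 2 ∧ (q.2 i).2.1 ^ 2 + (q.2 i).2.2 ^ 2 < r ^ 2) ∧ ∑ i, (q.2 i).1 = 2 * Real.pi ∧ (fun i : Fin n => (!₂[(2 / ((1 + (((q.2 i).2.1 ^ 2 + (q.2 i).2.2 ^ 2) / r ^ 2)) + (1 - (((q.2 i).2.1 ^ 2 + (q.2 i).2.2 ^ 2) / r ^ 2)) * Real.cos (∑ j : Fin n, if j < i then (q.2 j).1 else 0))) * (q.2 i).2.1, (2 / ((1 + (((q.2 i).2.1 ^ 2 + (q.2 i).2.2 ^ 2) / r ^ 2)) + (1 - (((q.2 i).2.1 ^ 2 + (q.2 i).2.2 ^ 2) / r ^ 2)) * Real.cos (∑ j : Fin n, if j < i then (q.2 j).1 else 0))) * (q.2 i).2.2, -(r / 2) * (1 - (((q.2 i).2.1 ^ 2 + (q.2 i).2.2 ^ 2) / r ^ 2)) * Real.sin (∑ j : Fin n, if j < i then (q.2 j).1 else 0) * (2 / ((1 + (((q.2 i).2.1 ^ 2 + (q.2 i).2.2 ^ 2) / r ^ 2)) + (1 - (((q.2 i).2.1 ^ 2 + (q.2 i).2.2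 ^ 2) / r ^ 2)) * Real.cos (∑ j : Fin n, if j < i then (q.2 j).1 else 0)))] : EuclideanSpace ℝ (Fin 3))) ∈ Literature.Probability.LatticeModels.NonCoincident 3 n} → (fun q => (∏ i : Fin n, (2 / ((1 + (((q.2 i).2.1 ^ 2 + (q.2 i).2.2 ^ 2) / r ^ 2)) + (1 - (((q.2 i).2.1 ^ 2 + (q.2 i).2.2 ^ 2) / r ^ 2)) * Real.cos (q.1 + ∑ j : Fin n, if j < i then (q.2 j).1 else 0)))) ^ Δ * S n (fun i : Fin n => (!₂[(2 / ((1 + (((q.2 i).2.1 ^ 2 + (q.2 i).2.2 ^ 2) / r ^ 2)) + (1 - (((q.2 i).2.1 ^ 2 + (q.2 i).2.2 ^ 2) / r ^ 2)) * Real.cos (q.1 + ∑ j : Fin n, if j < i then (q.2 j).1 else 0))) * (q.2 i).2.1, (2 / ((1 + (((q.2 i).2.1 ^ 2 + (q.2 i).2.2 ^ 2) / r ^ 2)) + (1 - (((q.2 i).2.1 ^ 2 + (q.2 i).2.2 ^ 2) / r ^ 2)) * Real.cos (q.1 + ∑ j : Fin n, if j < i then (q.2 j).1 else 0))) * (q.2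 i).2.2, -(r / 2) * (1 - (((q.2 i).2.1 ^ 2 + (q.2 i).2.2 ^ 2) / r ^ 2)) * Real.sin (q.1 + ∑ j : Fin n, if j < i then (q.2 j).1 else 0) * (2 / ((1 + (((q.2 i).2.1 ^ 2 + (q.2 i).2.2 ^ 2) / r ^ 2)) + (1 - (((q.2 i).2.1 ^ 2 + (q.2 i).2.2 ^ 2) / r ^ 2)) * Real.cos (q.1 + ∑ j : Fin n, if j < i then (q.2 j).1 else 0)))] : EuclideanSpace ℝ (Fin 3)))) q = (fun q => (∏ i : Fin n, (2 / ((1 + (((q.2 i).2.1 ^ 2 + (q.2 i).2.2 ^ 2) / r ^ 2)) + (1 - (((q.2 i).2.1 ^ 2 + (q.2 i).2.2 ^ 2) / r ^ 2)) * Real.cos (q.1 + ∑ j : Fin n, if j < i then (q.2 j).1 else 0)))) ^ Δ * S n (fun i : Fin n => (!₂[(2 / ((1 + (((q.2 i).2.1 ^ 2 + (q.2 i).2.2 ^ 2) / r ^ 2)) + (1 - (((q.2 i).2.1 ^ 2 + (q.2 i).2.2 ^ 2) / r ^ 2)) * Real.cos (q.1 + ∑ j : Fin n, if j < i then (q.2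 j).1 else 0))) * (q.2 i).2.1, (2 / ((1 + (((q.2 i).2.1 ^ 2 + (q.2 i).2.2 ^ 2) / r ^ 2)) + (1 - (((q.2 i).2.1 ^ 2 + (q.2 i).2.2 ^ 2) / r ^ 2)) * Real.cos (q.1 + ∑ j : Fin n, if j < i then (q.2 j).1 else 0))) * (q.2 i).2.2, -(r / 2) * (1 - (((q.2 i).2.1 ^ 2 + (q.2 i).2.2 ^ 2) / r ^ 2)) * Real.sin (q.1 + ∑ j : Fin n, if j < i then (q.2 j).1 else 0) * (2 / ((1 + (((q.2 i).2.1 ^ 2 + (q.2 i).2.2 ^ 2) / r ^ 2)) + (1 - (((q.2 i).2.1 ^ 2 + (q.2 i).2.2 ^ 2) / r ^ 2)) * Real.cos (q.1 + ∑ j : Fin n, if j < i then (q.2 j).1 else 0)))] : EuclideanSpace ℝ (Fin 3)))) ((0:ℝ), q.2) := by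
  sorry

/-! ### Name-keyed aliases of the three stub statements (verbatim the types of the `stub_*` theorems
above; the skeleton audit admits hypotheses of `BallModularMoebius_of` only BY NAME) -/
namespace Registered

/-- Alias of the statement of `stub_zeroOffsetFlow`, keyed by the registered stub name. -/
abbrev stub_zeroOffsetFlow : Prop := ∀ (ρ : ℝ → ℝ) (Δ : ℝ) (S : Literature.Probability.LatticeModels.CorrFamily 3), (∀ δ ∈ Set.Ioc (0:ℝ) 1, 0 < ρ δ) → 0 < Δ → Literature.Probability.LatticeModels.HasPointwiseScalingLimit (Literature.Probability.LatticeModels.criticalCorr 3) ρ S → (∀ n z, z ∉ Literature.Probability.LatticeModels.NonCoincident 3 n → S n z = 0) → Literature.Probability.LatticeModels.IsNondegenerateTwoPoint S → Literature.Probability.LatticeModels.IsEuclideanInvariant S → Literature.Probability.LatticeModels.IsScaleCovariant Δ S → ∀ r : ℝ, 0 < r → ∃ L : ℝ → ℕ, ∀ n : ℕ, TendstoLocallyUniformlyOn (fun (δ : ℝ) (q : ℝ × (Fin n → ℝ × ℝ × ℝ)) => ρ δ ^ n * (let D : Finset (Literature.Probability.LatticeModels.Site 3) := (Literature.Probability.LatticeModels.box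 3 (L δ)).filter (fun x => x 2 = 0 ∧ ((x 0 : ℤ) : ℝ) ^ 2 + ((x 1 : ℤ) : ℝ) ^ 2 < (r / δ) ^ 2); let E : Finset (Literature.Probability.LatticeModels.Site 3) := (Literature.Probability.LatticeModels.box 3 (L δ)).filter (fun x => x 2 = 0 ∧ ¬ (((x 0 : ℤ) : ℝ) ^ 2 + ((x 1 : ℤ) : ℝ) ^ 2 < (r / δ) ^ 2)); let Pr : (↥D → ℤˣ) → (↥E → ℤˣ) → ℝ := fun σ η => Literature.Probability.LatticeModels.isingExpect (Literature.Probability.LatticeModels.zdGraph 3) (Literature.Probability.LatticeModels.box 3 (L δ)) (Literature.Probability.LatticeModels.criticalBeta 3) 0 Literature.Probability.LatticeModels.BoundaryCondition.plus (fun ω => (∏ x : ↥D, if ω x.1 = σ x then (1:ℝ) else 0) * ∏ y : ↥E, if ω y.1 = η y then (1:ℝ) else 0); let K : Matrix (↥D → ℤˣ) (↥D → ℤˣ) ℝ := Matrix.of (fun τ' τ => ∑ η : ↥E → ℤˣ, Real.sqrt (Pr τ' η * Pr τ η)); let G : Fin n → Matrix (↥D → ℤˣ) (↥D → ℤˣ)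 ℝ := fun i => Matrix.diagonal (fun τ => if h : (![⌊(q.2 i).2.1 / δ⌋, ⌊(q.2 i).2.2 / δ⌋, 0] : Literature.Probability.LatticeModels.Site 3) ∈ D then (((τ ⟨_, h⟩ : ℤˣ) : ℤ) : ℝ) else 0); Matrix.trace ((List.ofFn (fun i : Fin n => G i * cfc (fun x : ℝ => x ^ ((q.2 i).1 / (2 * Real.pi))) K)).prod))) (fun q => (∏ i : Fin n, (2 / ((1 + (((q.2 i).2.1 ^ 2 + (q.2 i).2.2 ^ 2) / r ^ 2)) + (1 - (((q.2 i).2.1 ^ 2 + (q.2 i).2.2 ^ 2) / r ^ 2)) * Real.cos (q.1 + ∑ j : Fin n, if j < i then (q.2 j).1 else 0)))) ^ Δ * S n (fun i : Fin n => (!₂[(2 / ((1 + (((q.2 i).2.1 ^ 2 + (q.2 i).2.2 ^ 2) / r ^ 2)) + (1 - (((q.2 i).2.1 ^ 2 + (q.2 i).2.2 ^ 2) / r ^ 2)) * Real.cos (q.1 + ∑ j : Fin n, if j < i then (q.2 j).1 else 0))) * (q.2 i).2.1, (2 / ((1 + (((q.2 i).2.1 ^ 2 + (q.2 i).2.2 ^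 2) / r ^ 2)) + (1 - (((q.2 i).2.1 ^ 2 + (q.2 i).2.2 ^ 2) / r ^ 2)) * Real.cos (q.1 + ∑ j : Fin n, if j < i then (q.2 j).1 else 0))) * (q.2 i).2.2, -(r / 2) * (1 - (((q.2 i).2.1 ^ 2 + (q.2 i).2.2 ^ 2) / r ^ 2)) * Real.sin (q.1 + ∑ j : Fin n, if j < i then (q.2 j).1 else 0) * (2 / ((1 + (((q.2 i).2.1 ^ 2 + (q.2 i).2.2 ^ 2) / r ^ 2)) + (1 - (((q.2 i).2.1 ^ 2 + (q.2 i).2.2 ^ 2) / r ^ 2)) * Real.cos (q.1 + ∑ j : Fin n, if j < i then (q.2 j).1 else 0)))] : EuclideanSpace ℝ (Fin 3)))) (nhdsWithin (0:ℝ) (Set.Ioi 0)) {q : ℝ × (Fin n → ℝ × ℝ × ℝ) | q.1 = 0 ∧ (∀ i, 0 ≤ (q.2 i).1 ∧ 0 < (q.2 i).2.1 ^ 2 + (q.2 i).2.2 ^ 2 ∧ (q.2 i).2.1 ^ 2 + (q.2 i).2.2 ^ 2 < r ^ 2) ∧ ∑ i, (q.2 i).1 = 2 * Real.pi ∧ (fun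 i : Fin n => (!₂[(2 / ((1 + (((q.2 i).2.1 ^ 2 + (q.2 i).2.2 ^ 2) / r ^ 2)) + (1 - (((q.2 i).2.1 ^ 2 + (q.2 i).2.2 ^ 2) / r ^ 2)) * Real.cos (∑ j : Fin n, if j < i then (q.2 j).1 else 0))) * (q.2 i).2.1, (2 / ((1 + (((q.2 i).2.1 ^ 2 + (q.2 i).2.2 ^ 2) / r ^ 2)) + (1 - (((q.2 i).2.1 ^ 2 + (q.2 i).2.2 ^ 2) / r ^ 2)) * Real.cos (∑ j : Fin n, if j < i then (q.2 j).1 else 0))) * (q.2 i).2.2, -(r / 2) * (1 - (((q.2 i).2.1 ^ 2 + (q.2 i).2.2 ^ 2) / r ^ 2)) * Real.sin (∑ j : Fin n, if j < i then (q.2 j).1 else 0) * (2 / ((1 + (((q.2 i).2.1 ^ 2 + (q.2 i).2.2 ^ 2) / r ^ 2)) + (1 - (((q.2 i).2.1 ^ 2 + (q.2 i).2.2 ^ 2) / r ^ 2)) * Real.cos (∑ j : Fin n, if j < i then (q.2 j).1 else 0)))] : EuclideanSpace ℝ (Fin 3))) ∈ Literature.Probability.LatticeModels.NonCoincident 3 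n}

/-- Alias of the statement of `stub_cyclicInversion`, keyed by the registered stub name. -/
abbrev stub_cyclicInversion : Prop := ∀ (ρ : ℝ → ℝ) (Δ : ℝ) (S : Literature.Probability.LatticeModels.CorrFamily 3), (∀ δ ∈ Set.Ioc (0:ℝ) 1, 0 < ρ δ) → 0 < Δ → Literature.Probability.LatticeModels.HasPointwiseScalingLimit (Literature.Probability.LatticeModels.criticalCorr 3) ρ S → (∀ n z, z ∉ Literature.Probability.LatticeModels.NonCoincident 3 n → S n z = 0) → Literature.Probability.LatticeModels.IsNondegenerateTwoPoint S → Literature.Probability.LatticeModels.IsEuclideanInvariant S → Literature.Probability.LatticeModels.IsScaleCovariant Δ S → (∀ r : ℝ, 0 < r → ∃ L : ℝ → ℕ, ∀ n : ℕ, TendstoLocallyUniformlyOn (fun (δ : ℝ) (q : ℝ × (Fin n → ℝ × ℝ × ℝ)) => ρ δ ^ n * (let D : Finset (Literature.Probability.LatticeModels.Site 3) := (Literature.Probability.LatticeModels.box 3 (L δ)).filter (fun x => x 2 = 0 ∧ ((x 0 : ℤ) : ℝ) ^ 2 + ((x 1 : ℤ) : ℝ) ^ 2 < (r / δ) ^ 2);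 let E : Finset (Literature.Probability.LatticeModels.Site 3) := (Literature.Probability.LatticeModels.box 3 (L δ)).filter (fun x => x 2 = 0 ∧ ¬ (((x 0 : ℤ) : ℝ) ^ 2 + ((x 1 : ℤ) : ℝ) ^ 2 < (r / δ) ^ 2)); let Pr : (↥D → ℤˣ) → (↥E → ℤˣ) → ℝ := fun σ η => Literature.Probability.LatticeModels.isingExpect (Literature.Probability.LatticeModels.zdGraph 3) (Literature.Probability.LatticeModels.box 3 (L δ)) (Literature.Probability.LatticeModels.criticalBeta 3) 0 Literature.Probability.LatticeModels.BoundaryCondition.plus (fun ω => (∏ x : ↥D, if ω x.1 = σ x then (1:ℝ) else 0) * ∏ y : ↥E, if ω y.1 = η y then (1:ℝ) else 0); let K : Matrix (↥D → ℤˣ) (↥D → ℤˣ) ℝ := Matrix.of (fun τ' τ => ∑ η : ↥E → ℤˣ, Real.sqrt (Pr τ' η * Pr τ η)); let G : Fin n → Matrix (↥D → ℤˣ) (↥D → ℤˣ) ℝ := fun i => Matrix.diagonal (fun τ => if h : (![⌊(q.2 i).2.1 / δ⌋, ⌊(q.2 i).2.2 / δ⌋, 0] : Literature.Probability.LatticeModels.Site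 3) ∈ D then (((τ ⟨_, h⟩ : ℤˣ) : ℤ) : ℝ) else 0); Matrix.trace ((List.ofFn (fun i : Fin n => G i * cfc (fun x : ℝ => x ^ ((q.2 i).1 / (2 * Real.pi))) K)).prod))) (fun q => (∏ i : Fin n, (2 / ((1 + (((q.2 i).2.1 ^ 2 + (q.2 i).2.2 ^ 2) / r ^ 2)) + (1 - (((q.2 i).2.1 ^ 2 + (q.2 i).2.2 ^ 2) / r ^ 2)) * Real.cos (q.1 + ∑ j : Fin n, if j < i then (q.2 j).1 else 0)))) ^ Δ * S n (fun i : Fin n => (!₂[(2 / ((1 + (((q.2 i).2.1 ^ 2 + (q.2 i).2.2 ^ 2) / r ^ 2)) + (1 - (((q.2 i).2.1 ^ 2 + (q.2 i).2.2 ^ 2) / r ^ 2)) * Real.cos (q.1 + ∑ j : Fin n, if j < i then (q.2 j).1 else 0))) * (q.2 i).2.1, (2 / ((1 + (((q.2 i).2.1 ^ 2 + (q.2 i).2.2 ^ 2) / r ^ 2)) + (1 - (((q.2 i).2.1 ^ 2 + (q.2 i).2.2 ^ 2) / r ^ 2)) * Real.cos (q.1 + ∑ j : Fin n, if j < i then (q.2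 j).1 else 0))) * (q.2 i).2.2, -(r / 2) * (1 - (((q.2 i).2.1 ^ 2 + (q.2 i).2.2 ^ 2) / r ^ 2)) * Real.sin (q.1 + ∑ j : Fin n, if j < i then (q.2 j).1 else 0) * (2 / ((1 + (((q.2 i).2.1 ^ 2 + (q.2 i).2.2 ^ 2) / r ^ 2)) + (1 - (((q.2 i).2.1 ^ 2 + (q.2 i).2.2 ^ 2) / r ^ 2)) * Real.cos (q.1 + ∑ j : Fin n, if j < i then (q.2 j).1 else 0)))] : EuclideanSpace ℝ (Fin 3)))) (nhdsWithin (0:ℝ) (Set.Ioi 0)) {q : ℝ × (Fin n → ℝ × ℝ × ℝ) | q.1 = 0 ∧ (∀ i, 0 ≤ (q.2 i).1 ∧ 0 < (q.2 i).2.1 ^ 2 + (q.2 i).2.2 ^ 2 ∧ (q.2 i).2.1 ^ 2 + (q.2 i).2.2 ^ 2 < r ^ 2) ∧ ∑ i, (q.2 i).1 = 2 * Real.pi ∧ (fun i : Fin n => (!₂[(2 / ((1 + (((q.2 i).2.1 ^ 2 + (q.2 i).2.2 ^ 2) / r ^ 2)) + (1 - (((q.2 i).2.1 ^ 2 + (q.2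 i).2.2 ^ 2) / r ^ 2)) * Real.cos (∑ j : Fin n, if j < i then (q.2 j).1 else 0))) * (q.2 i).2.1, (2 / ((1 + (((q.2 i).2.1 ^ 2 + (q.2 i).2.2 ^ 2) / r ^ 2)) + (1 - (((q.2 i).2.1 ^ 2 + (q.2 i).2.2 ^ 2) / r ^ 2)) * Real.cos (∑ j : Fin n, if j < i then (q.2 j).1 else 0))) * (q.2 i).2.2, -(r / 2) * (1 - (((q.2 i).2.1 ^ 2 + (q.2 i).2.2 ^ 2) / r ^ 2)) * Real.sin (∑ j : Fin n, if j < i then (q.2 j).1 else 0) * (2 / ((1 + (((q.2 i).2.1 ^ 2 + (q.2 i).2.2 ^ 2) / r ^ 2)) + (1 - (((q.2 i).2.1 ^ 2 + (q.2 i).2.2 ^ 2) / r ^ 2)) * Real.cos (∑ j : Fin n, if j < i then (q.2 j).1 else 0)))] : EuclideanSpace ℝ (Fin 3))) ∈ Literature.Probability.LatticeModels.NonCoincident 3 n}) → Literature.Probability.LatticeModels.IsInversionCovariant Δ S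

/-- Alias of the statement of `stub_toroidalOrbit`, keyed by the registered stub name. -/
abbrev stub_toroidalOrbit : Prop := ∀ (ρ : ℝ → ℝ) (Δ : ℝ) (S : Literature.Probability.LatticeModels.CorrFamily 3), (∀ δ ∈ Set.Ioc (0:ℝ) 1, 0 < ρ δ) → 0 < Δ → Literature.Probability.LatticeModels.HasPointwiseScalingLimit (Literature.Probability.LatticeModels.criticalCorr 3) ρ S → (∀ n z, z ∉ Literature.Probability.LatticeModels.NonCoincident 3 n → S n z = 0) → Literature.Probability.LatticeModels.IsNondegenerateTwoPoint S → Literature.Probability.LatticeModels.IsEuclideanInvariant S → Literature.Probability.LatticeModels.IsScaleCovariant Δ S → Literature.Probability.LatticeModels.IsInversionCovariant Δ S → ∀ r : ℝ, 0 < r → ∀ n : ℕ, ∀ q : ℝ × (Fin n → ℝ × ℝ × ℝ), q ∈ {q : ℝ × (Fin n → ℝ × ℝ × ℝ) | (∀ i, 0 ≤ (q.2 i).1 ∧ 0 < (q.2 i).2.1 ^ 2 + (q.2 i).2.2 ^ 2 ∧ (q.2 i).2.1 ^ 2 + (q.2 i).2.2 ^ 2 < r ^ 2) ∧ ∑ i,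 (q.2 i).1 = 2 * Real.pi ∧ (fun i : Fin n => (!₂[(2 / ((1 + (((q.2 i).2.1 ^ 2 + (q.2 i).2.2 ^ 2) / r ^ 2)) + (1 - (((q.2 i).2.1 ^ 2 + (q.2 i).2.2 ^ 2) / r ^ 2)) * Real.cos (∑ j : Fin n, if j < i then (q.2 j).1 else 0))) * (q.2 i).2.1, (2 / ((1 + (((q.2 i).2.1 ^ 2 + (q.2 i).2.2 ^ 2) / r ^ 2)) + (1 - (((q.2 i).2.1 ^ 2 + (q.2 i).2.2 ^ 2) / r ^ 2)) * Real.cos (∑ j : Fin n, if j < i then (q.2 j).1 else 0))) * (q.2 i).2.2, -(r / 2) * (1 - (((q.2 i).2.1 ^ 2 + (q.2 i).2.2 ^ 2) / r ^ 2)) * Real.sin (∑ j : Fin n, if j < i then (q.2 j).1 else 0) * (2 / ((1 + (((q.2 i).2.1 ^ 2 + (q.2 i).2.2 ^ 2) / r ^ 2)) + (1 - (((q.2 i).2.1 ^ 2 + (q.2 i).2.2 ^ 2) / r ^ 2)) * Real.cos (∑ j : Fin n, if j < i then (q.2 j).1 else 0)))] : EuclideanSpace ℝ (Fin 3))) ∈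 Literature.Probability.LatticeModels.NonCoincident 3 n} → (fun q => (∏ i : Fin n, (2 / ((1 + (((q.2 i).2.1 ^ 2 + (q.2 i).2.2 ^ 2) / r ^ 2)) + (1 - (((q.2 i).2.1 ^ 2 + (q.2 i).2.2 ^ 2) / r ^ 2)) * Real.cos (q.1 + ∑ j : Fin n, if j < i then (q.2 j).1 else 0)))) ^ Δ * S n (fun i : Fin n => (!₂[(2 / ((1 + (((q.2 i).2.1 ^ 2 + (q.2 i).2.2 ^ 2) / r ^ 2)) + (1 - (((q.2 i).2.1 ^ 2 + (q.2 i).2.2 ^ 2) / r ^ 2)) * Real.cos (q.1 + ∑ j : Fin n, if j < i then (q.2 j).1 else 0))) * (q.2 i).2.1, (2 / ((1 + (((q.2 i).2.1 ^ 2 + (q.2 i).2.2 ^ 2) / r ^ 2)) + (1 - (((q.2 i).2.1 ^ 2 + (q.2 i).2.2 ^ 2) / r ^ 2)) * Real.cos (q.1 + ∑ j : Fin n, if j < i then (q.2 j).1 else 0))) * (q.2 i).2.2, -(r / 2) * (1 - (((q.2 i).2.1 ^ 2 + (q.2 i).2.2 ^ 2) / r ^ 2)) * Real.sin (q.1 +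 ∑ j : Fin n, if j < i then (q.2 j).1 else 0) * (2 / ((1 + (((q.2 i).2.1 ^ 2 + (q.2 i).2.2 ^ 2) / r ^ 2)) + (1 - (((q.2 i).2.1 ^ 2 + (q.2 i).2.2 ^ 2) / r ^ 2)) * Real.cos (q.1 + ∑ j : Fin n, if j < i then (q.2 j).1 else 0)))] : EuclideanSpace ℝ (Fin 3)))) q = (fun q => (∏ i : Fin n, (2 / ((1 + (((q.2 i).2.1 ^ 2 + (q.2 i).2.2 ^ 2) / r ^ 2)) + (1 - (((q.2 i).2.1 ^ 2 + (q.2 i).2.2 ^ 2) / r ^ 2)) * Real.cos (q.1 + ∑ j : Fin n, if j < i then (q.2 j).1 else 0)))) ^ Δ * S n (fun i : Fin n => (!₂[(2 / ((1 + (((q.2 i).2.1 ^ 2 + (q.2 i).2.2 ^ 2) / r ^ 2)) + (1 - (((q.2 i).2.1 ^ 2 + (q.2 i).2.2 ^ 2) / r ^ 2)) * Real.cos (q.1 + ∑ j : Fin n, if j < i then (q.2 j).1 else 0))) * (q.2 i).2.1, (2 / ((1 + (((q.2 i).2.1 ^ 2 + (q.2 i).2.2 ^ 2) / r ^ 2))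 + (1 - (((q.2 i).2.1 ^ 2 + (q.2 i).2.2 ^ 2) / r ^ 2)) * Real.cos (q.1 + ∑ j : Fin n, if j < i then (q.2 j).1 else 0))) * (q.2 i).2.2, -(r / 2) * (1 - (((q.2 i).2.1 ^ 2 + (q.2 i).2.2 ^ 2) / r ^ 2)) * Real.sin (q.1 + ∑ j : Fin n, if j < i then (q.2 j).1 else 0) * (2 / ((1 + (((q.2 i).2.1 ^ 2 + (q.2 i).2.2 ^ 2) / r ^ 2)) + (1 - (((q.2 i).2.1 ^ 2 + (q.2 i).2.2 ^ 2) / r ^ 2)) * Real.cos (q.1 + ∑ j : Fin n, if j < i then (q.2 j).1 else 0)))] : EuclideanSpace ℝ (Fin 3)))) ((0:ℝ), q.2)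

end Registered

/-- Glue lemma (proved): locally uniform convergence on the zero-offset slice of an offset-free
domain, for an offset-free sequence and a target that is constant in the offset on the domain,
is locally uniform convergence on the whole domain (pull the slice neighbourhood back along the
continuous retraction `q ↦ (0, q.2)`). [folklore] -/
theorem tendstoLocallyUniformlyOn_of_slice {X : Type*} [TopologicalSpace X] {ι : Type*}
    {p : Filter ι} {F : ι → ℝ × X → ℝ} {T : ℝ × X → ℝ} {D : Set (ℝ × X)}
    (hF : ∀ i q, F i q = F i ((0:ℝ), q.2))
    (hD : ∀ q, q ∈ D → ((0:ℝ), q.2) ∈ D)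
    (hT : ∀ q, q ∈ D → T q = T ((0:ℝ), q.2))
    (h : TendstoLocallyUniformlyOn F T p {q : ℝ × X | q.1 = 0 ∧ q ∈ D}) :
    TendstoLocallyUniformlyOn F T p D := by
  intro u hu q hq
  obtain ⟨t, ht, hev⟩ := h u hu ((0:ℝ), q.2) ⟨rfl, hD q hq⟩
  obtain ⟨O, hO, hqO, hOt⟩ := mem_nhdsWithin.1 ht
  have hπ : Continuous (fun y : ℝ × X => ((0:ℝ), y.2)) := by fun_prop
  refine ⟨(fun y : ℝ × X => ((0:ℝ), y.2)) ⁻¹' O ∩ D, ?_, ?_⟩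
  · exact mem_nhdsWithin.2 ⟨_, hO.preimage hπ, hqO, Subset.rfl⟩
  · filter_upwards [hev] with i hi y hy
    have hy0 : ((0:ℝ), y.2) ∈ t := hOt ⟨hy.1, rfl, hD y hy.2⟩
    have := hi _ hy0
    rwa [← hT y hy.2, ← hF i y] at this

/-- ASSEMBLY (kernel-checked, no sorry): the three stubs imply the crux, literally the route decl
`Summit.CriticalPhenomena.Ising3DConformalLimit.Theses.ModularQuarterTurn.BallModularMoebius`.
Zero-offset convergence (stub 1) feeds the cyclic bootstrap (stub 2) to get inversion covariance,
the toroidal-orbit bookkeeping (stub 3) turns that into offset-constancy of the target, and the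
glue lemma lifts slice convergence to the full domain (word and domain do not contain the offset:
both side conditions are `rfl` / `id`). -/
theorem BallModularMoebius_of (h1 : Registered.stub_zeroOffsetFlow)
    (h2 : Registered.stub_cyclicInversion) (h3 : Registered.stub_toroidalOrbit) :
    Summit.CriticalPhenomena.Ising3DConformalLimit.Theses.ModularQuarterTurn.BallModularMoebius := by
  intro ρ Δ S hρ hΔ hlim hnorm hnd heuc hsc r hr
  have h1' := h1 ρ Δ S hρ hΔ hlim hnorm hnd heuc hsc
  have hinv : Literature.Probability.LatticeModels.IsInversionCovariant Δ S :=
    h2 ρ Δ S hρ hΔ hlim hnorm hnd heuc hsc h1'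
  have hoff := h3 ρ Δ S hρ hΔ hlim hnorm hnd heuc hsc hinv r hr
  obtain ⟨L, hL⟩ := h1' r hr
  refine ⟨L, fun n => ?_⟩
  exact tendstoLocallyUniformlyOn_of_slice (fun _ _ => rfl) (fun _ hq => hq) (hoff n) (hL n)

/-- The same assembly with the registered stubs plugged in (sorries only inside `stub_*`). -/
theorem BallModularMoebius_of_stubs : Summit.CriticalPhenomena.Ising3DConformalLimit.Theses.ModularQuarterTurn.BallModularMoebius :=
  BallModularMoebius_of stub_zeroOffsetFlow stub_cyclicInversion stub_toroidalOrbit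

end Summit.CriticalPhenomena.Ising3DConformalLimit.Cruxes.BallModularMoebius.Birth
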